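import Summits.RiemannHypothesis.RiemannHypothesis.Theorems.WeilCombCombShapePositivityBumpQuadratureAux
import Summits.RiemannHypothesis.RiemannHypothesis.Theorems.WeilCombCombShapePositivityBumpEnclosuresA
import Summits.RiemannHypothesis.RiemannHypothesis.Theorems.WeilCombCombShapePositivityBumpEnclosuresB

/-!
# Enclosure of `∫₀¹ φ₀²` by one-sided quadrature (ranges and total)
(crux `WeilComb.CombShapePositivity`, item stmt-RiemannHypothesis-11229; constant `N = ‖φ₀‖₂² = 2∫₀¹φ₀²`)

`φ₀(u)² = exp(−2/(1−u²))` on `[0,1)`, concave on `[0, 9/16]`, convex on `[289/500, 19/20]` (`3u⁴ + 2u² − 1` changes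
sign at `3^{-1/2} = 0.5773…`); same method as `…BumpIntegralRanges`.
-/

noncomputable section

-- the sub-problem path RiemannHypothesis/RiemannHypothesis duplicates a namespace (D-0017)
set_option linter.dupNamespace false

open Real Set MeasureTheory intervalIntegral

namespace Summit.RiemannHypothesis.RiemannHypothesis.Theorems.WeilCombBohrFejer

/-- `φ₀` is continuous (local copy; the tree's `continuous_shapeBump` lives in `…BumpCellBounds`). [folklore] -/
private theorem continuous_shapeBump_loc : Continuous fun u : ℝ => expNegInvGlue (1 - u ^ 2) :=
  (expNegInvGlue.contDiff (n := 0)).continuous.comp (continuous_const.sub (continuous_pow 2))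

/-- `∫ φ₀²` over `[0, 1/4]` is in `[0.032381032, 0.032446834]` (4 pieces). [folklore] -/
theorem integral_shapeBump_sq_range1 :
    (∫ x in (0 : ℝ)..1 / 4, expNegInvGlue (1 - x ^ 2) ^ 2) ∈ Icc (0.032381032 : ℝ) 0.032446834 := by
  have hsplit2 : ∀ a b c : ℝ, ∫ x in a..c, expNegInvGlue (1 - x ^ 2) ^ 2 =
      (∫ x in a..b, expNegInvGlue (1 - x ^ 2) ^ 2) + ∫ x in b..c, expNegInvGlue (1 - x ^ 2) ^ 2 := fun a b c =>
    (intervalIntegral.integral_add_adjacent_intervals ((continuous_shapeBump_loc.pow 2).intervalIntegrable _ _)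
      ((continuous_shapeBump_loc.pow 2).intervalIntegrable _ _)).symm
  have concF2 := concaveOn_bumpExp_two
  have convF2 := convexOn_bumpExp_two
  have up2_0_1_16 : ∫ x in (0 : ℝ)..1 / 16, expNegInvGlue (1 - x ^ 2) ^ 2 ≤
      ((1 / 16 : ℝ) - 0) * (Real.exp (-2 / (1 - (0 : ℝ) ^ 2)) + Real.exp (-2 / (1 - (1 / 16 : ℝ) ^ 2))) / 2 +
        ((1 / 16 : ℝ) - 0) ^ 2 / 8 * (Real.exp (-2 / (1 - (0 : ℝ) ^ 2)) * (-(2 * 2 * (0 : ℝ)) / (1 - (0 : ℝ) ^ 2) ^ 2) -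
          Real.exp (-2 / (1 - (1 / 16 : ℝ) ^ 2)) * (-(2 * 2 * (1 / 16 : ℝ)) / (1 - (1 / 16 : ℝ) ^ 2) ^ 2)) :=
    (integral_shapeBump_sq_eq_bumpExp (a := 0) (b := 1 / 16) (by norm_num) (by norm_num) (by norm_num)).trans_le
    (integral_le_tangentTrapezoid_of_concaveOn (by norm_num)
      (concF2.subset (Set.Icc_subset_Icc (by norm_num) (by norm_num)) (convex_Icc _ _))
      (continuousOn_bumpExp 2 (by norm_num) (by norm_num))
      (hasDerivAt_bumpExp 2 (u := 0) (by norm_num)) (hasDerivAt_bumpExp 2 (u := 1 / 16) (by norm_num)))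
  have lo2_0_1_16 : ((1 / 16 : ℝ) - 0) * (Real.exp (-2 / (1 - (0 : ℝ) ^ 2)) + Real.exp (-2 / (1 - (1 / 16 : ℝ) ^ 2))) / 2 ≤
      ∫ x in (0 : ℝ)..1 / 16, expNegInvGlue (1 - x ^ 2) ^ 2 :=
    (trapezoid_le_integral_of_concaveOn (by norm_num)
      (concF2.subset (Set.Icc_subset_Icc (by norm_num) (by norm_num)) (convex_Icc _ _))
      (continuousOn_bumpExp 2 (by norm_num) (by norm_num))).trans_eq
    (integral_shapeBump_sq_eq_bumpExp (a := 0) (b := 1 / 16) (by norm_num) (by norm_num) (by norm_num)).symm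
  have up2_1_16_1_8 : ∫ x in (1 / 16 : ℝ)..1 / 8, expNegInvGlue (1 - x ^ 2) ^ 2 ≤
      ((1 / 8 : ℝ) - 1 / 16) * (Real.exp (-2 / (1 - (1 / 16 : ℝ) ^ 2)) + Real.exp (-2 / (1 - (1 / 8 : ℝ) ^ 2))) / 2 +
        ((1 / 8 : ℝ) - 1 / 16) ^ 2 / 8 * (Real.exp (-2 / (1 - (1 / 16 : ℝ) ^ 2)) * (-(2 * 2 * (1 / 16 : ℝ)) / (1 - (1 / 16 : ℝ) ^ 2) ^ 2) -
          Real.exp (-2 / (1 - (1 / 8 : ℝ) ^ 2)) * (-(2 * 2 * (1 / 8 : ℝ)) / (1 - (1 / 8 : ℝ) ^ 2) ^ 2)) :=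
    (integral_shapeBump_sq_eq_bumpExp (a := 1 / 16) (b := 1 / 8) (by norm_num) (by norm_num) (by norm_num)).trans_le
    (integral_le_tangentTrapezoid_of_concaveOn (by norm_num)
      (concF2.subset (Set.Icc_subset_Icc (by norm_num) (by norm_num)) (convex_Icc _ _))
      (continuousOn_bumpExp 2 (by norm_num) (by norm_num))
      (hasDerivAt_bumpExp 2 (u := 1 / 16) (by norm_num)) (hasDerivAt_bumpExp 2 (u := 1 / 8) (by norm_num)))
  have lo2_1_16_1_8 : ((1 / 8 : ℝ) - 1 / 16) * (Real.exp (-2 / (1 - (1 / 16 : ℝ) ^ 2)) + Real.exp (-2 / (1 - (1 / 8 : ℝ) ^ 2))) / 2 ≤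
      ∫ x in (1 / 16 : ℝ)..1 / 8, expNegInvGlue (1 - x ^ 2) ^ 2 :=
    (trapezoid_le_integral_of_concaveOn (by norm_num)
      (concF2.subset (Set.Icc_subset_Icc (by norm_num) (by norm_num)) (convex_Icc _ _))
      (continuousOn_bumpExp 2 (by norm_num) (by norm_num))).trans_eq
    (integral_shapeBump_sq_eq_bumpExp (a := 1 / 16) (b := 1 / 8) (by norm_num) (by norm_num) (by norm_num)).symm
  have up2_1_8_3_16 : ∫ x in (1 / 8 : ℝ)..3 / 16, expNegInvGlue (1 - x ^ 2) ^ 2 ≤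
      ((3 / 16 : ℝ) - 1 / 8) * (Real.exp (-2 / (1 - (1 / 8 : ℝ) ^ 2)) + Real.exp (-2 / (1 - (3 / 16 : ℝ) ^ 2))) / 2 +
        ((3 / 16 : ℝ) - 1 / 8) ^ 2 / 8 * (Real.exp (-2 / (1 - (1 / 8 : ℝ) ^ 2)) * (-(2 * 2 * (1 / 8 : ℝ)) / (1 - (1 / 8 : ℝ) ^ 2) ^ 2) -
          Real.exp (-2 / (1 - (3 / 16 : ℝ) ^ 2)) * (-(2 * 2 * (3 / 16 : ℝ)) / (1 - (3 / 16 : ℝ) ^ 2) ^ 2)) :=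
    (integral_shapeBump_sq_eq_bumpExp (a := 1 / 8) (b := 3 / 16) (by norm_num) (by norm_num) (by norm_num)).trans_le
    (integral_le_tangentTrapezoid_of_concaveOn (by norm_num)
      (concF2.subset (Set.Icc_subset_Icc (by norm_num) (by norm_num)) (convex_Icc _ _))
      (continuousOn_bumpExp 2 (by norm_num) (by norm_num))
      (hasDerivAt_bumpExp 2 (u := 1 / 8) (by norm_num)) (hasDerivAt_bumpExp 2 (u := 3 / 16) (by norm_num)))
  have lo2_1_8_3_16 : ((3 / 16 : ℝ) - 1 / 8) * (Real.exp (-2 / (1 - (1 / 8 : ℝ) ^ 2)) + Real.exp (-2 / (1 - (3 / 16 : ℝ) ^ 2))) / 2 ≤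
      ∫ x in (1 / 8 : ℝ)..3 / 16, expNegInvGlue (1 - x ^ 2) ^ 2 :=
    (trapezoid_le_integral_of_concaveOn (by norm_num)
      (concF2.subset (Set.Icc_subset_Icc (by norm_num) (by norm_num)) (convex_Icc _ _))
      (continuousOn_bumpExp 2 (by norm_num) (by norm_num))).trans_eq
    (integral_shapeBump_sq_eq_bumpExp (a := 1 / 8) (b := 3 / 16) (by norm_num) (by norm_num) (by norm_num)).symm
  have up2_3_16_1_4 : ∫ x in (3 / 16 : ℝ)..1 / 4, expNegInvGlue (1 - x ^ 2) ^ 2 ≤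
      ((1 / 4 : ℝ) - 3 / 16) * (Real.exp (-2 / (1 - (3 / 16 : ℝ) ^ 2)) + Real.exp (-2 / (1 - (1 / 4 : ℝ) ^ 2))) / 2 +
        ((1 / 4 : ℝ) - 3 / 16) ^ 2 / 8 * (Real.exp (-2 / (1 - (3 / 16 : ℝ) ^ 2)) * (-(2 * 2 * (3 / 16 : ℝ)) / (1 - (3 / 16 : ℝ) ^ 2) ^ 2) -
          Real.exp (-2 / (1 - (1 / 4 : ℝ) ^ 2)) * (-(2 * 2 * (1 / 4 : ℝ)) / (1 - (1 / 4 : ℝ) ^ 2) ^ 2)) :=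
    (integral_shapeBump_sq_eq_bumpExp (a := 3 / 16) (b := 1 / 4) (by norm_num) (by norm_num) (by norm_num)).trans_le
    (integral_le_tangentTrapezoid_of_concaveOn (by norm_num)
      (concF2.subset (Set.Icc_subset_Icc (by norm_num) (by norm_num)) (convex_Icc _ _))
      (continuousOn_bumpExp 2 (by norm_num) (by norm_num))
      (hasDerivAt_bumpExp 2 (u := 3 / 16) (by norm_num)) (hasDerivAt_bumpExp 2 (u := 1 / 4) (by norm_num)))
  have lo2_3_16_1_4 : ((1 / 4 : ℝ) - 3 / 16) * (Real.exp (-2 / (1 - (3 / 16 : ℝ) ^ 2)) + Real.exp (-2 / (1 - (1 / 4 : ℝ) ^ 2))) / 2 ≤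
      ∫ x in (3 / 16 : ℝ)..1 / 4, expNegInvGlue (1 - x ^ 2) ^ 2 :=
    (trapezoid_le_integral_of_concaveOn (by norm_num)
      (concF2.subset (Set.Icc_subset_Icc (by norm_num) (by norm_num)) (convex_Icc _ _))
      (continuousOn_bumpExp 2 (by norm_num) (by norm_num))).trans_eq
    (integral_shapeBump_sq_eq_bumpExp (a := 3 / 16) (b := 1 / 4) (by norm_num) (by norm_num) (by norm_num)).symm
  obtain ⟨e1lo_0, e1hi_0, e2lo_0, e2hi_0⟩ := bumpEncl_0
  obtain ⟨e1lo_1_16, e1hi_1_16, e2lo_1_16, e2hi_1_16⟩ := bumpEncl_1_16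
  obtain ⟨e1lo_1_8, e1hi_1_8, e2lo_1_8, e2hi_1_8⟩ := bumpEncl_1_8
  obtain ⟨e1lo_3_16, e1hi_3_16, e2lo_3_16, e2hi_3_16⟩ := bumpEncl_3_16
  obtain ⟨e1lo_1_4, e1hi_1_4, e2lo_1_4, e2hi_1_4⟩ := bumpEncl_1_4
  rw [hsplit2 (0) (1 / 16) (1 / 4),
    hsplit2 (1 / 16) (1 / 8) (1 / 4),
    hsplit2 (1 / 8) (3 / 16) (1 / 4)]
  rw [Set.mem_Icc]
  constructor <;> linarith


/-- `∫ φ₀²` over `[1/4, 1/2]` is in `[0.024050916, 0.024105747]` (4 pieces). [folklore] -/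
theorem integral_shapeBump_sq_range2 :
    (∫ x in (1 / 4 : ℝ)..1 / 2, expNegInvGlue (1 - x ^ 2) ^ 2) ∈ Icc (0.024050916 : ℝ) 0.024105747 := by
  have hsplit2 : ∀ a b c : ℝ, ∫ x in a..c, expNegInvGlue (1 - x ^ 2) ^ 2 =
      (∫ x in a..b, expNegInvGlue (1 - x ^ 2) ^ 2) + ∫ x in b..c, expNegInvGlue (1 - x ^ 2) ^ 2 := fun a b c =>
    (intervalIntegral.integral_add_adjacent_intervals ((continuous_shapeBump_loc.pow 2).intervalIntegrable _ _)
      ((continuous_shapeBump_loc.pow 2).intervalIntegrable _ _)).symm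
  have concF2 := concaveOn_bumpExp_two
  have convF2 := convexOn_bumpExp_two
  have up2_1_4_5_16 : ∫ x in (1 / 4 : ℝ)..5 / 16, expNegInvGlue (1 - x ^ 2) ^ 2 ≤
      ((5 / 16 : ℝ) - 1 / 4) * (Real.exp (-2 / (1 - (1 / 4 : ℝ) ^ 2)) + Real.exp (-2 / (1 - (5 / 16 : ℝ) ^ 2))) / 2 +
        ((5 / 16 : ℝ) - 1 / 4) ^ 2 / 8 * (Real.exp (-2 / (1 - (1 / 4 : ℝ) ^ 2)) * (-(2 * 2 * (1 / 4 : ℝ)) / (1 - (1 / 4 : ℝ) ^ 2) ^ 2) -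
          Real.exp (-2 / (1 - (5 / 16 : ℝ) ^ 2)) * (-(2 * 2 * (5 / 16 : ℝ)) / (1 - (5 / 16 : ℝ) ^ 2) ^ 2)) :=
    (integral_shapeBump_sq_eq_bumpExp (a := 1 / 4) (b := 5 / 16) (by norm_num) (by norm_num) (by norm_num)).trans_le
    (integral_le_tangentTrapezoid_of_concaveOn (by norm_num)
      (concF2.subset (Set.Icc_subset_Icc (by norm_num) (by norm_num)) (convex_Icc _ _))
      (continuousOn_bumpExp 2 (by norm_num) (by norm_num))
      (hasDerivAt_bumpExp 2 (u := 1 / 4) (by norm_num)) (hasDerivAt_bumpExp 2 (u := 5 / 16) (by norm_num)))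
  have lo2_1_4_5_16 : ((5 / 16 : ℝ) - 1 / 4) * (Real.exp (-2 / (1 - (1 / 4 : ℝ) ^ 2)) + Real.exp (-2 / (1 - (5 / 16 : ℝ) ^ 2))) / 2 ≤
      ∫ x in (1 / 4 : ℝ)..5 / 16, expNegInvGlue (1 - x ^ 2) ^ 2 :=
    (trapezoid_le_integral_of_concaveOn (by norm_num)
      (concF2.subset (Set.Icc_subset_Icc (by norm_num) (by norm_num)) (convex_Icc _ _))
      (continuousOn_bumpExp 2 (by norm_num) (by norm_num))).trans_eq
    (integral_shapeBump_sq_eq_bumpExp (a := 1 / 4) (b := 5 / 16) (by norm_num) (by norm_num) (by norm_num)).symm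
  have up2_5_16_3_8 : ∫ x in (5 / 16 : ℝ)..3 / 8, expNegInvGlue (1 - x ^ 2) ^ 2 ≤
      ((3 / 8 : ℝ) - 5 / 16) * (Real.exp (-2 / (1 - (5 / 16 : ℝ) ^ 2)) + Real.exp (-2 / (1 - (3 / 8 : ℝ) ^ 2))) / 2 +
        ((3 / 8 : ℝ) - 5 / 16) ^ 2 / 8 * (Real.exp (-2 / (1 - (5 / 16 : ℝ) ^ 2)) * (-(2 * 2 * (5 / 16 : ℝ)) / (1 - (5 / 16 : ℝ) ^ 2) ^ 2) -
          Real.exp (-2 / (1 - (3 / 8 : ℝ) ^ 2)) * (-(2 * 2 * (3 / 8 : ℝ)) / (1 - (3 / 8 : ℝ) ^ 2) ^ 2)) :=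
    (integral_shapeBump_sq_eq_bumpExp (a := 5 / 16) (b := 3 / 8) (by norm_num) (by norm_num) (by norm_num)).trans_le
    (integral_le_tangentTrapezoid_of_concaveOn (by norm_num)
      (concF2.subset (Set.Icc_subset_Icc (by norm_num) (by norm_num)) (convex_Icc _ _))
      (continuousOn_bumpExp 2 (by norm_num) (by norm_num))
      (hasDerivAt_bumpExp 2 (u := 5 / 16) (by norm_num)) (hasDerivAt_bumpExp 2 (u := 3 / 8) (by norm_num)))
  have lo2_5_16_3_8 : ((3 / 8 : ℝ) - 5 / 16) * (Real.exp (-2 / (1 - (5 / 16 : ℝ) ^ 2)) + Real.exp (-2 / (1 - (3 / 8 : ℝ) ^ 2))) / 2 ≤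
      ∫ x in (5 / 16 : ℝ)..3 / 8, expNegInvGlue (1 - x ^ 2) ^ 2 :=
    (trapezoid_le_integral_of_concaveOn (by norm_num)
      (concF2.subset (Set.Icc_subset_Icc (by norm_num) (by norm_num)) (convex_Icc _ _))
      (continuousOn_bumpExp 2 (by norm_num) (by norm_num))).trans_eq
    (integral_shapeBump_sq_eq_bumpExp (a := 5 / 16) (b := 3 / 8) (by norm_num) (by norm_num) (by norm_num)).symm
  have up2_3_8_7_16 : ∫ x in (3 / 8 : ℝ)..7 / 16, expNegInvGlue (1 - x ^ 2) ^ 2 ≤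
      ((7 / 16 : ℝ) - 3 / 8) * (Real.exp (-2 / (1 - (3 / 8 : ℝ) ^ 2)) + Real.exp (-2 / (1 - (7 / 16 : ℝ) ^ 2))) / 2 +
        ((7 / 16 : ℝ) - 3 / 8) ^ 2 / 8 * (Real.exp (-2 / (1 - (3 / 8 : ℝ) ^ 2)) * (-(2 * 2 * (3 / 8 : ℝ)) / (1 - (3 / 8 : ℝ) ^ 2) ^ 2) -
          Real.exp (-2 / (1 - (7 / 16 : ℝ) ^ 2)) * (-(2 * 2 * (7 / 16 : ℝ)) / (1 - (7 / 16 : ℝ) ^ 2) ^ 2)) :=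
    (integral_shapeBump_sq_eq_bumpExp (a := 3 / 8) (b := 7 / 16) (by norm_num) (by norm_num) (by norm_num)).trans_le
    (integral_le_tangentTrapezoid_of_concaveOn (by norm_num)
      (concF2.subset (Set.Icc_subset_Icc (by norm_num) (by norm_num)) (convex_Icc _ _))
      (continuousOn_bumpExp 2 (by norm_num) (by norm_num))
      (hasDerivAt_bumpExp 2 (u := 3 / 8) (by norm_num)) (hasDerivAt_bumpExp 2 (u := 7 / 16) (by norm_num)))
  have lo2_3_8_7_16 : ((7 / 16 : ℝ) - 3 / 8) * (Real.exp (-2 / (1 - (3 / 8 : ℝ) ^ 2)) + Real.exp (-2 / (1 - (7 / 16 : ℝ) ^ 2))) / 2 ≤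
      ∫ x in (3 / 8 : ℝ)..7 / 16, expNegInvGlue (1 - x ^ 2) ^ 2 :=
    (trapezoid_le_integral_of_concaveOn (by norm_num)
      (concF2.subset (Set.Icc_subset_Icc (by norm_num) (by norm_num)) (convex_Icc _ _))
      (continuousOn_bumpExp 2 (by norm_num) (by norm_num))).trans_eq
    (integral_shapeBump_sq_eq_bumpExp (a := 3 / 8) (b := 7 / 16) (by norm_num) (by norm_num) (by norm_num)).symm
  have up2_7_16_1_2 : ∫ x in (7 / 16 : ℝ)..1 / 2, expNegInvGlue (1 - x ^ 2) ^ 2 ≤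
      ((1 / 2 : ℝ) - 7 / 16) * (Real.exp (-2 / (1 - (7 / 16 : ℝ) ^ 2)) + Real.exp (-2 / (1 - (1 / 2 : ℝ) ^ 2))) / 2 +
        ((1 / 2 : ℝ) - 7 / 16) ^ 2 / 8 * (Real.exp (-2 / (1 - (7 / 16 : ℝ) ^ 2)) * (-(2 * 2 * (7 / 16 : ℝ)) / (1 - (7 / 16 : ℝ) ^ 2) ^ 2) -
          Real.exp (-2 / (1 - (1 / 2 : ℝ) ^ 2)) * (-(2 * 2 * (1 / 2 : ℝ)) / (1 - (1 / 2 : ℝ) ^ 2) ^ 2)) :=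
    (integral_shapeBump_sq_eq_bumpExp (a := 7 / 16) (b := 1 / 2) (by norm_num) (by norm_num) (by norm_num)).trans_le
    (integral_le_tangentTrapezoid_of_concaveOn (by norm_num)
      (concF2.subset (Set.Icc_subset_Icc (by norm_num) (by norm_num)) (convex_Icc _ _))
      (continuousOn_bumpExp 2 (by norm_num) (by norm_num))
      (hasDerivAt_bumpExp 2 (u := 7 / 16) (by norm_num)) (hasDerivAt_bumpExp 2 (u := 1 / 2) (by norm_num)))
  have lo2_7_16_1_2 : ((1 / 2 : ℝ) - 7 / 16) * (Real.exp (-2 / (1 - (7 / 16 : ℝ) ^ 2)) + Real.exp (-2 / (1 - (1 / 2 : ℝ) ^ 2))) / 2 ≤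
      ∫ x in (7 / 16 : ℝ)..1 / 2, expNegInvGlue (1 - x ^ 2) ^ 2 :=
    (trapezoid_le_integral_of_concaveOn (by norm_num)
      (concF2.subset (Set.Icc_subset_Icc (by norm_num) (by norm_num)) (convex_Icc _ _))
      (continuousOn_bumpExp 2 (by norm_num) (by norm_num))).trans_eq
    (integral_shapeBump_sq_eq_bumpExp (a := 7 / 16) (b := 1 / 2) (by norm_num) (by norm_num) (by norm_num)).symm
  obtain ⟨e1lo_1_4, e1hi_1_4, e2lo_1_4, e2hi_1_4⟩ := bumpEncl_1_4
  obtain ⟨e1lo_5_16, e1hi_5_16, e2lo_5_16, e2hi_5_16⟩ := bumpEncl_5_16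
  obtain ⟨e1lo_3_8, e1hi_3_8, e2lo_3_8, e2hi_3_8⟩ := bumpEncl_3_8
  obtain ⟨e1lo_7_16, e1hi_7_16, e2lo_7_16, e2hi_7_16⟩ := bumpEncl_7_16
  obtain ⟨e1lo_1_2, e1hi_1_2, e2lo_1_2, e2hi_1_2⟩ := bumpEncl_1_2
  rw [hsplit2 (1 / 4) (5 / 16) (1 / 2),
    hsplit2 (5 / 16) (3 / 8) (1 / 2),
    hsplit2 (3 / 8) (7 / 16) (1 / 2)]
  rw [Set.mem_Icc]
  constructor <;> linarith


/-- `∫ φ₀²` over `[1/2, 11/16]` is in `[0.008526284, 0.008610093]` (4 pieces). [folklore] -/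
theorem integral_shapeBump_sq_range3 :
    (∫ x in (1 / 2 : ℝ)..11 / 16, expNegInvGlue (1 - x ^ 2) ^ 2) ∈ Icc (0.008526284 : ℝ) 0.008610093 := by
  have hsplit2 : ∀ a b c : ℝ, ∫ x in a..c, expNegInvGlue (1 - x ^ 2) ^ 2 =
      (∫ x in a..b, expNegInvGlue (1 - x ^ 2) ^ 2) + ∫ x in b..c, expNegInvGlue (1 - x ^ 2) ^ 2 := fun a b c =>
    (intervalIntegral.integral_add_adjacent_intervals ((continuous_shapeBump_loc.pow 2).intervalIntegrable _ _)
      ((continuous_shapeBump_loc.pow 2).intervalIntegrable _ _)).symm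
  have concF2 := concaveOn_bumpExp_two
  have convF2 := convexOn_bumpExp_two
  have up2_1_2_9_16 : ∫ x in (1 / 2 : ℝ)..9 / 16, expNegInvGlue (1 - x ^ 2) ^ 2 ≤
      ((9 / 16 : ℝ) - 1 / 2) * (Real.exp (-2 / (1 - (1 / 2 : ℝ) ^ 2)) + Real.exp (-2 / (1 - (9 / 16 : ℝ) ^ 2))) / 2 +
        ((9 / 16 : ℝ) - 1 / 2) ^ 2 / 8 * (Real.exp (-2 / (1 - (1 / 2 : ℝ) ^ 2)) * (-(2 * 2 * (1 / 2 : ℝ)) / (1 - (1 / 2 : ℝ) ^ 2) ^ 2) -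
          Real.exp (-2 / (1 - (9 / 16 : ℝ) ^ 2)) * (-(2 * 2 * (9 / 16 : ℝ)) / (1 - (9 / 16 : ℝ) ^ 2) ^ 2)) :=
    (integral_shapeBump_sq_eq_bumpExp (a := 1 / 2) (b := 9 / 16) (by norm_num) (by norm_num) (by norm_num)).trans_le
    (integral_le_tangentTrapezoid_of_concaveOn (by norm_num)
      (concF2.subset (Set.Icc_subset_Icc (by norm_num) (by norm_num)) (convex_Icc _ _))
      (continuousOn_bumpExp 2 (by norm_num) (by norm_num))
      (hasDerivAt_bumpExp 2 (u := 1 / 2) (by norm_num)) (hasDerivAt_bumpExp 2 (u := 9 / 16) (by norm_num)))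
  have lo2_1_2_9_16 : ((9 / 16 : ℝ) - 1 / 2) * (Real.exp (-2 / (1 - (1 / 2 : ℝ) ^ 2)) + Real.exp (-2 / (1 - (9 / 16 : ℝ) ^ 2))) / 2 ≤
      ∫ x in (1 / 2 : ℝ)..9 / 16, expNegInvGlue (1 - x ^ 2) ^ 2 :=
    (trapezoid_le_integral_of_concaveOn (by norm_num)
      (concF2.subset (Set.Icc_subset_Icc (by norm_num) (by norm_num)) (convex_Icc _ _))
      (continuousOn_bumpExp 2 (by norm_num) (by norm_num))).trans_eq
    (integral_shapeBump_sq_eq_bumpExp (a := 1 / 2) (b := 9 / 16) (by norm_num) (by norm_num) (by norm_num)).symm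
  have up2_9_16_289_500 : ∫ x in (9 / 16 : ℝ)..289 / 500, expNegInvGlue (1 - x ^ 2) ^ 2 ≤
      ((289 / 500 : ℝ) - 9 / 16) * Real.exp (-2 / (1 - (9 / 16 : ℝ) ^ 2)) :=
    (integral_le_of_antitoneOn_bumpQuad (by norm_num) (shapeBump_sq_antitoneOn.mono (Icc_subset_Ici_bumpQuad (by norm_num)))).trans_eq
    (congrArg (fun r : ℝ => ((289 / 500 : ℝ) - 9 / 16) * r) (shapeBump_sq_eq_bumpExp (u := 9 / 16) (by norm_num)))
  have lo2_9_16_289_500 : ((289 / 500 : ℝ) - 9 / 16) * Real.exp (-2 / (1 - (289 / 500 : ℝ) ^ 2)) ≤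
      ∫ x in (9 / 16 : ℝ)..289 / 500, expNegInvGlue (1 - x ^ 2) ^ 2 :=
    (congrArg (fun r : ℝ => ((289 / 500 : ℝ) - 9 / 16) * r) (shapeBump_sq_eq_bumpExp (u := 289 / 500) (by norm_num))).symm.trans_le
    (le_integral_of_antitoneOn_bumpQuad (by norm_num) (shapeBump_sq_antitoneOn.mono (Icc_subset_Ici_bumpQuad (by norm_num))))
  have up2_289_500_5_8 : ∫ x in (289 / 500 : ℝ)..5 / 8, expNegInvGlue (1 - x ^ 2) ^ 2 ≤
      ((5 / 8 : ℝ) - 289 / 500) * (Real.exp (-2 / (1 - (289 / 500 : ℝ) ^ 2)) + Real.exp (-2 / (1 - (5 / 8 : ℝ) ^ 2))) / 2 :=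
    (integral_shapeBump_sq_eq_bumpExp (a := 289 / 500) (b := 5 / 8) (by norm_num) (by norm_num) (by norm_num)).trans_le
    (integral_le_trapezoid_of_convexOn (by norm_num)
      (convF2.subset (Set.Icc_subset_Icc (by norm_num) (by norm_num)) (convex_Icc _ _))
      (continuousOn_bumpExp 2 (by norm_num) (by norm_num)))
  have lo2_289_500_5_8 : ((5 / 8 : ℝ) - 289 / 500) * (Real.exp (-2 / (1 - (289 / 500 : ℝ) ^ 2)) + Real.exp (-2 / (1 - (5 / 8 : ℝ) ^ 2))) / 2 +
        ((5 / 8 : ℝ) - 289 / 500) ^ 2 / 8 * (Real.exp (-2 / (1 - (289 / 500 : ℝ) ^ 2)) * (-(2 * 2 * (289 / 500 : ℝ)) / (1 - (289 / 500 : ℝ) ^ 2) ^ 2) -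
          Real.exp (-2 / (1 - (5 / 8 : ℝ) ^ 2)) * (-(2 * 2 * (5 / 8 : ℝ)) / (1 - (5 / 8 : ℝ) ^ 2) ^ 2)) ≤
      ∫ x in (289 / 500 : ℝ)..5 / 8, expNegInvGlue (1 - x ^ 2) ^ 2 :=
    (tangentTrapezoid_le_integral_of_convexOn (by norm_num)
      (convF2.subset (Set.Icc_subset_Icc (by norm_num) (by norm_num)) (convex_Icc _ _))
      (continuousOn_bumpExp 2 (by norm_num) (by norm_num))
      (hasDerivAt_bumpExp 2 (u := 289 / 500) (by norm_num)) (hasDerivAt_bumpExp 2 (u := 5 / 8) (by norm_num))).trans_eq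
    (integral_shapeBump_sq_eq_bumpExp (a := 289 / 500) (b := 5 / 8) (by norm_num) (by norm_num) (by norm_num)).symm
  have up2_5_8_11_16 : ∫ x in (5 / 8 : ℝ)..11 / 16, expNegInvGlue (1 - x ^ 2) ^ 2 ≤
      ((11 / 16 : ℝ) - 5 / 8) * (Real.exp (-2 / (1 - (5 / 8 : ℝ) ^ 2)) + Real.exp (-2 / (1 - (11 / 16 : ℝ) ^ 2))) / 2 :=
    (integral_shapeBump_sq_eq_bumpExp (a := 5 / 8) (b := 11 / 16) (by norm_num) (by norm_num) (by norm_num)).trans_le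
    (integral_le_trapezoid_of_convexOn (by norm_num)
      (convF2.subset (Set.Icc_subset_Icc (by norm_num) (by norm_num)) (convex_Icc _ _))
      (continuousOn_bumpExp 2 (by norm_num) (by norm_num)))
  have lo2_5_8_11_16 : ((11 / 16 : ℝ) - 5 / 8) * (Real.exp (-2 / (1 - (5 / 8 : ℝ) ^ 2)) + Real.exp (-2 / (1 - (11 / 16 : ℝ) ^ 2))) / 2 +
        ((11 / 16 : ℝ) - 5 / 8) ^ 2 / 8 * (Real.exp (-2 / (1 - (5 / 8 : ℝ) ^ 2)) * (-(2 * 2 * (5 / 8 : ℝ)) / (1 - (5 / 8 : ℝ) ^ 2) ^ 2) -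
          Real.exp (-2 / (1 - (11 / 16 : ℝ) ^ 2)) * (-(2 * 2 * (11 / 16 : ℝ)) / (1 - (11 / 16 : ℝ) ^ 2) ^ 2)) ≤
      ∫ x in (5 / 8 : ℝ)..11 / 16, expNegInvGlue (1 - x ^ 2) ^ 2 :=
    (tangentTrapezoid_le_integral_of_convexOn (by norm_num)
      (convF2.subset (Set.Icc_subset_Icc (by norm_num) (by norm_num)) (convex_Icc _ _))
      (continuousOn_bumpExp 2 (by norm_num) (by norm_num))
      (hasDerivAt_bumpExp 2 (u := 5 / 8) (by norm_num)) (hasDerivAt_bumpExp 2 (u := 11 / 16) (by norm_num))).trans_eq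
    (integral_shapeBump_sq_eq_bumpExp (a := 5 / 8) (b := 11 / 16) (by norm_num) (by norm_num) (by norm_num)).symm
  obtain ⟨e1lo_1_2, e1hi_1_2, e2lo_1_2, e2hi_1_2⟩ := bumpEncl_1_2
  obtain ⟨e1lo_9_16, e1hi_9_16, e2lo_9_16, e2hi_9_16⟩ := bumpEncl_9_16
  obtain ⟨e1lo_289_500, e1hi_289_500, e2lo_289_500, e2hi_289_500⟩ := bumpEncl_289_500
  obtain ⟨e1lo_5_8, e1hi_5_8, e2lo_5_8, e2hi_5_8⟩ := bumpEncl_5_8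
  obtain ⟨e1lo_11_16, e1hi_11_16, e2lo_11_16, e2hi_11_16⟩ := bumpEncl_11_16
  rw [hsplit2 (1 / 2) (9 / 16) (11 / 16),
    hsplit2 (9 / 16) (289 / 500) (11 / 16),
    hsplit2 (289 / 500) (5 / 8) (11 / 16)]
  rw [Set.mem_Icc]
  constructor <;> linarith

end Summit.RiemannHypothesis.RiemannHypothesis.Theorems.WeilCombBohrFejer

end
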